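import Mathlib
import HarnessLib
import Summits.CriticalPhenomena.CardyFormulaZ2.Theses.CardySelfDualSegment
import Literature.Probability.Percolation.CornerPercolation
import Literature.Analysis.Complex.VitaliConvergence
import Summits.CriticalPhenomena.CardyFormulaZ2.Theorems.CardySelfDualSegmentSegmentOpenStubCrossingProbPolynomial
import Summits.CriticalPhenomena.CardyFormulaZ2.Theorems.CardySelfDualSegmentSegmentOpenStubGoodSetNhdsZeroOfJets
import Summits.CriticalPhenomena.CardyFormulaZ2.Theorems.CardyQContinuationJetLimitLemma

/-!
# Crux `SegmentOpen` (stmt-CriticalPhenomena-5471), line `Sketch` — census: JC is necessary under S4w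

Lead c5, reshape 7 (GLOBAL JETS).  The research stub JC `stub_jetConv` (convergence of every
coefficient of the crossing polynomials `p_δ(t) = P_t(R', δ)` as `δ → 0⁺`) is not an extra
assumption of the line: under the pointwise complex bound S4w `stub_localComplexBound` (taken as a
hypothesis, NOT claimed) at the single centre `t₀ = 0`, JC for `R'` follows from the mere
EXISTENCE of scaling limits of the crossing probabilities `P_{u n}(R', δ)` along ANY sequence of
parameters `u n → 0`, `u n ≠ 0` (no identification of the limits is needed).  In particular
S4w ∧ (0 is an accumulation point of the good set `G`) ⊢ JC, and S4w ∧ Target ⊢ JC; so given S4w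
the jet statements JC ∧ JI of the line are NECESSARY for the Target as well as sufficient (GJ,
p134197).  Proof: Vitali's convergence theorem on the S4w disc `B(0, r)` (pointwise convergence at
the points `u n` accumulating at `0`; tree `Literature.Analysis.Complex.VitaliConvergence`) along
every sequence of meshes, the identity theorem to see that the limit does not depend on the
sequence, and Weierstrass' theorem for the jets (`JetLimit.tendstoLocallyUniformlyOn_iteratedDeriv`).
-/

noncomputable section

namespace Summit.CriticalPhenomena.CardyFormulaZ2.Theorems

open Literature.Probability Literature.Barriers.CriticalPhenomena
open Literature.Probability.RandomPlanarGeometry (ConformalRectangle ConformalEquiv MarkedDomain)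
open Filter Set Topology MeasureTheory
open UpperHalfPlane (upperHalfPlaneSet)

namespace JetConvOfLimits

/-- A real sequence `u m → 0` with `u m ≠ 0` tends to `0` within `{0}ᶜ` in `ℂ`. -/
theorem tendsto_ofReal_nhdsNE {u : ℕ → ℝ} (hu : Tendsto u atTop (𝓝 0)) (hu0 : ∀ m, u m ≠ 0) :
    Tendsto (fun m => ((u m : ℝ) : ℂ)) atTop (𝓝[≠] (0 : ℂ)) :=
  tendsto_nhdsWithin_iff.2 ⟨by
      have h := (Complex.continuous_ofReal.tendsto 0).comp hu
      rw [Complex.ofReal_zero] at h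
      exact h,
    Eventually.of_forall fun m => by simpa using hu0 m⟩

/-- **One sequence of meshes.**  Complex polynomials `P δ`, bounded by `C` on `B(0, r)` for
`0 < δ < δ₁`, whose real evaluations at the points `u m` (`u m → 0`, `u m ≠ 0`, `|u m| < r`)
converge as `δ → 0⁺`: along every sequence of meshes `d n → 0⁺` they converge locally uniformly on
the disc (Vitali) to a holomorphic `g` taking the limiting values at the `u m`, and every
coefficient converges to the corresponding Taylor coefficient of `g` at `0` (Weierstrass). -/
theorem exists_limit_seq {P : ℝ → Polynomial ℝ} {r δ₁ C : ℝ} (hr : 0 < r) (hδ₁ : 0 < δ₁)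
    (hC : ∀ δ : ℝ, 0 < δ → δ < δ₁ →
      ∀ z ∈ Metric.ball (0 : ℂ) r, ‖((P δ).map (algebraMap ℝ ℂ)).eval z‖ ≤ C)
    {u : ℕ → ℝ} (hu : Tendsto u atTop (𝓝 0)) (hu0 : ∀ m, u m ≠ 0) (hur : ∀ m, |u m| < r)
    {L : ℕ → ℝ} (hL : ∀ m, Tendsto (fun δ => (P δ).eval (u m)) (𝓝[>] 0) (𝓝 (L m)))
    {d : ℕ → ℝ} (hd : Tendsto d atTop (𝓝[>] 0)) :
    ∃ g : ℂ → ℂ, DifferentiableOn ℂ g (Metric.ball (0 : ℂ) r) ∧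
      (∀ m, g (u m) = L m) ∧
      ∀ k : ℕ, Tendsto (fun n => (((P (d n)).coeff k : ℝ) : ℂ)) atTop
        (𝓝 ((k.factorial : ℂ)⁻¹ * iteratedDeriv k g 0)) := by
  classical
  -- admissible meshes, eventually all of them
  have hgood : ∀ᶠ n in atTop, 0 < d n ∧ d n < δ₁ := by
    have h1 : ∀ᶠ n in atTop, d n ∈ Ioo 0 δ₁ := hd (Ioo_mem_nhdsGT hδ₁)
    exact h1.mono fun n hn => hn
  -- the holomorphic sequence on the disc
  set U : Set ℂ := Metric.ball (0 : ℂ) r with hU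
  set F : ℕ → ℂ → ℂ := fun n =>
    if 0 < d n ∧ d n < δ₁ then fun z => ((P (d n)).map (algebraMap ℝ ℂ)).eval z else 0 with hF
  have hFgood : ∀ n, 0 < d n ∧ d n < δ₁ →
      F n = fun z => ((P (d n)).map (algebraMap ℝ ℂ)).eval z := fun n hn => by
    simp only [hF, if_pos hn]
  have hFbad : ∀ n, ¬ (0 < d n ∧ d n < δ₁) → F n = 0 := fun n hn => by
    simp only [hF, if_neg hn]
  have hUo : IsOpen U := Metric.isOpen_ball
  have hUc : IsPreconnected U := (convex_ball (0 : ℂ) r).isPreconnected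
  have h0U : (0 : ℂ) ∈ U := Metric.mem_ball_self hr
  have hFd : ∀ n, DifferentiableOn ℂ (F n) U := fun n => by
    by_cases hn : 0 < d n ∧ d n < δ₁
    · rw [hFgood n hn]
      exact (Polynomial.differentiable _).differentiableOn
    · rw [hFbad n hn]
      exact differentiableOn_const 0
  have hFb : ∀ w ∈ U, ∃ M : ℝ, ∃ ρ > 0, ∀ n, ∀ z ∈ Metric.ball w ρ ∩ U, ‖F n z‖ ≤ M := by
    intro w _
    refine ⟨max C 0, 1, one_pos, fun n z hz => ?_⟩
    by_cases hn : 0 < d n ∧ d n < δ₁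
    · rw [hFgood n hn]
      exact (hC (d n) hn.1 hn.2 z hz.2).trans (le_max_left _ _)
    · rw [hFbad n hn]
      simp
  -- pointwise convergence at the points `u m`
  have hpt : ∀ m, Tendsto (fun n => F n (u m)) atTop (𝓝 ((L m : ℝ) : ℂ)) := by
    intro m
    have h1 : Tendsto (fun n => (((P (d n)).eval (u m) : ℝ) : ℂ)) atTop (𝓝 ((L m : ℝ) : ℂ)) :=
      (Complex.continuous_ofReal.tendsto _).comp ((hL m).comp hd)
    refine h1.congr' ?_
    filter_upwards [hgood] with n hn
    rw [hFgood n hn]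
    change _ = ((P (d n)).map (algebraMap ℝ ℂ)).eval (algebraMap ℝ ℂ (u m))
    rw [Polynomial.eval_map, Polynomial.eval₂_at_apply]
    rfl
  have hS : ∃ᶠ z in 𝓝[≠] (0 : ℂ), ∃ c : ℂ, Tendsto (fun n => F n z) atTop (𝓝 c) :=
    (tendsto_ofReal_nhdsNE hu hu0).frequently (Frequently.of_forall fun m => ⟨_, hpt m⟩)
  -- Vitali
  obtain ⟨g, hgd, hgF⟩ :=
    Literature.Analysis.Complex.exists_tendstoLocallyUniformlyOn_of_frequently_tendsto hUo hUc
      hFd hFb h0U hS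
  refine ⟨g, hgd, fun m => ?_, fun k => ?_⟩
  · have hm : ((u m : ℝ) : ℂ) ∈ U := by
      rw [hU, Metric.mem_ball, dist_zero_right, Complex.norm_real, Real.norm_eq_abs]
      exact hur m
    exact tendsto_nhds_unique (hgF.tendsto_at hm) (hpt m)
  · -- Weierstrass: the jets at `0` converge
    have hW := (JetLimit.tendstoLocallyUniformlyOn_iteratedDeriv hUo hFd hgF k).tendsto_at h0U
    have h2 := hW.const_mul ((k.factorial : ℂ)⁻¹)
    refine h2.congr' ?_
    filter_upwards [hgood] with n hn
    show (k.factorial : ℂ)⁻¹ * iteratedDeriv k (F n) 0 = (((P (d n)).coeff k : ℝ) : ℂ)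
    rw [hFgood n hn, GoodSetNhdsZeroOfJets.iteratedDeriv_map_eval_zero]
    have hk : (k.factorial : ℂ) ≠ 0 := by exact_mod_cast Nat.factorial_ne_zero k
    field_simp

/-- **Coefficient convergence from the existence of limits.**  Under the hypotheses of
`exists_limit_seq`, every coefficient of `P δ` converges as `δ → 0⁺` (the Vitali limit does not
depend on the sequence of meshes, by the identity theorem through the points `u m → 0`). -/
theorem tendsto_coeff_of_limits {P : ℝ → Polynomial ℝ} {r δ₁ C : ℝ} (hr : 0 < r) (hδ₁ : 0 < δ₁)
    (hC : ∀ δ : ℝ, 0 < δ → δ < δ₁ →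
      ∀ z ∈ Metric.ball (0 : ℂ) r, ‖((P δ).map (algebraMap ℝ ℂ)).eval z‖ ≤ C)
    {u : ℕ → ℝ} (hu : Tendsto u atTop (𝓝 0)) (hu0 : ∀ m, u m ≠ 0) (hur : ∀ m, |u m| < r)
    {L : ℕ → ℝ} (hL : ∀ m, Tendsto (fun δ => (P δ).eval (u m)) (𝓝[>] 0) (𝓝 (L m)))
    (k : ℕ) : ∃ a : ℝ, Tendsto (fun δ => (P δ).coeff k) (𝓝[>] 0) (𝓝 a) := by
  -- a reference sequence of meshes
  have hd0 : Tendsto (fun n : ℕ => (1 : ℝ) / ((n : ℝ) + 2)) atTop (𝓝[>] 0) := by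
    refine tendsto_nhdsWithin_iff.2 ⟨?_, Eventually.of_forall fun n => ?_⟩
    · have h1 : Tendsto (fun n : ℕ => (n : ℝ) + 2) atTop atTop :=
        tendsto_natCast_atTop_atTop.atTop_add tendsto_const_nhds
      exact h1.const_div_atTop 1
    · show (1 : ℝ) / ((n : ℝ) + 2) ∈ Ioi 0
      exact mem_Ioi.2 (by positivity)
  obtain ⟨g₀, hg₀d, hg₀u, -⟩ := exists_limit_seq hr hδ₁ hC hu hu0 hur hL hd0
  refine ⟨((k.factorial : ℂ)⁻¹ * iteratedDeriv k g₀ 0).re, ?_⟩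
  rw [tendsto_iff_seq_tendsto]
  intro d hd
  obtain ⟨g, hgd, hgu, hgc⟩ := exists_limit_seq hr hδ₁ hC hu hu0 hur hL hd
  -- `g = g₀` on the disc: identity theorem through the points `u m → 0`
  have hEq : EqOn g g₀ (Metric.ball (0 : ℂ) r) := by
    refine (hgd.analyticOnNhd Metric.isOpen_ball).eqOn_of_preconnected_of_frequently_eq
      (hg₀d.analyticOnNhd Metric.isOpen_ball) (convex_ball _ _).isPreconnected
      (Metric.mem_ball_self hr) ?_
    exact (tendsto_ofReal_nhdsNE hu hu0).frequently
      (Frequently.of_forall fun m => by rw [hgu m, hg₀u m])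
  have hjet : iteratedDeriv k g 0 = iteratedDeriv k g₀ 0 :=
    Filter.EventuallyEq.iteratedDeriv_eq k (hEq.eventuallyEq_of_mem (Metric.ball_mem_nhds 0 hr))
  have h3 := (Complex.continuous_re.tendsto _).comp (hgc k)
  rw [hjet] at h3
  exact h3.congr fun n => by simp

end JetConvOfLimits

open JetConvOfLimits in
/-- **JC is necessary under S4w.**  Assume S4w (verbatim `stub_localComplexBound`; hypothesis,
NOT claimed).  If for a conformal rectangle `R'` the crossing probabilities `P_{u n}(R', δ)` have
limits as `δ → 0⁺` along SOME sequence of parameters `u n → 0`, `u n ≠ 0` (e.g. good points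
accumulating at `0`, or the route's `Target`), then every coefficient of the crossing polynomials
of `R'` converges as `δ → 0⁺` — the conclusion of JC `stub_jetConv` for `R'`. -/
theorem jetConv_of_localComplexBound_of_limits :
    (∀ (t₀ : unitInterval) (R : ConformalRectangle), ∃ r > 0, ∃ δ₁ > 0, ∃ C : ℝ, ∀ δ : ℝ,
      0 < δ → δ < δ₁ → ∀ p : Polynomial ℝ,
        (∀ t : unitInterval, Percolation.cornerCrossingProb t R δ = p.eval (t : ℝ)) →
        ∀ z ∈ Metric.ball ((t₀ : ℝ) : ℂ) r, ‖(p.map (algebraMap ℝ ℂ)).eval z‖ ≤ C) →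
    ∀ R' : ConformalRectangle,
      (∃ u : ℕ → unitInterval, Tendsto u atTop (𝓝 0) ∧ (∀ n, u n ≠ 0) ∧
        ∀ n, ∃ L : ℝ, Tendsto (Percolation.cornerCrossingProb (u n) R') (𝓝[>] 0) (𝓝 L)) →
      ∀ k : ℕ, ∃ a : ℝ, ∀ ε > 0, ∃ δ₀ > 0, ∀ δ : ℝ, 0 < δ → δ < δ₀ → ∀ p : Polynomial ℝ,
        (∀ t : unitInterval, Percolation.cornerCrossingProb t R' δ = p.eval (t : ℝ)) →
        |p.coeff k - a| < ε := by
  classical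
  intro h4 R' hlim k
  obtain ⟨u, hu, hune, hL⟩ := hlim
  choose L hL using hL
  -- the S4w disc at the centre `0` for `R'`, crossing polynomials from S1
  obtain ⟨r, hr, δ₁, hδ₁, C, hC⟩ := h4 0 R'
  have h00 : (((0 : unitInterval) : ℝ) : ℂ) = 0 := by simp
  rw [h00] at hC
  set P : ℝ → Polynomial ℝ := fun δ =>
    if h : 0 < δ then Classical.choose (stub_crossingProbPolynomial R' δ h) else 0 with hP
  have hPspec : ∀ δ : ℝ, 0 < δ → ∀ s : unitInterval,
      Percolation.cornerCrossingProb s R' δ = (P δ).eval (s : ℝ) := fun δ hδ => by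
    simp only [hP, dif_pos hδ]
    exact Classical.choose_spec (stub_crossingProbPolynomial R' δ hδ)
  have hCP : ∀ δ : ℝ, 0 < δ → δ < δ₁ →
      ∀ z ∈ Metric.ball (0 : ℂ) r, ‖((P δ).map (algebraMap ℝ ℂ)).eval z‖ ≤ C :=
    fun δ hδ hδ' z hz => hC δ hδ hδ' (P δ) (hPspec δ hδ) z hz
  -- drop the finitely many parameters outside the disc
  have hu' : Tendsto (fun m => ((u m : unitInterval) : ℝ)) atTop (𝓝 0) := by
    have h := (continuous_subtype_val.tendsto (0 : unitInterval)).comp hu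
    rw [Set.Icc.coe_zero] at h
    exact h
  have hur : ∀ᶠ m in atTop, |((u m : unitInterval) : ℝ)| < r := by
    have h2 := (continuous_abs.tendsto (0 : ℝ)).comp hu'
    rw [abs_zero] at h2
    exact h2.eventually (gt_mem_nhds hr)
  obtain ⟨N, hN⟩ := eventually_atTop.1 hur
  set v : ℕ → ℝ := fun m => ((u (m + N) : unitInterval) : ℝ) with hv
  have hv0 : Tendsto v atTop (𝓝 0) := hu'.comp (tendsto_add_atTop_nat N)
  have hvne : ∀ m, v m ≠ 0 := fun m h => hune (m + N) (Subtype.ext (by simpa [hv] using h))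
  have hvr : ∀ m, |v m| < r := fun m => hN (m + N) (Nat.le_add_left N m)
  have hvL : ∀ m, Tendsto (fun δ => (P δ).eval (v m)) (𝓝[>] 0) (𝓝 (L (m + N))) := by
    intro m
    refine (hL (m + N)).congr' ?_
    have hev : ∀ᶠ δ in 𝓝[>] (0 : ℝ), 0 < δ := self_mem_nhdsWithin
    filter_upwards [hev] with δ hδ using hPspec δ hδ (u (m + N))
  -- coefficient convergence along `𝓝[>] 0`, then the `ε`–`δ₀` form over the spec
  obtain ⟨a, ha⟩ := tendsto_coeff_of_limits hr hδ₁ hCP hv0 hvne hvr hvL k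
  refine ⟨a, fun ε hε => ?_⟩
  obtain ⟨δ₀, hδ₀, hδ⟩ := (Metric.tendsto_nhdsWithin_nhds.1 ha) ε hε
  refine ⟨δ₀, hδ₀, fun δ hδp hδl p hp => ?_⟩
  have hpP : p = P δ := by
    apply Polynomial.eq_of_infinite_eval_eq
    refine Set.Infinite.mono (s := range ((↑) : unitInterval → ℝ)) ?_ ?_
    · rintro _ ⟨t, rfl⟩
      show p.eval (t : ℝ) = (P δ).eval (t : ℝ)
      rw [← hp t, ← hPspec δ hδp t]
    · rw [Subtype.range_coe]
      exact Set.Icc_infinite zero_lt_one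
  rw [hpP]
  have := hδ (mem_Ioi.2 hδp) (by rwa [dist_zero_right, Real.norm_eq_abs, abs_of_pos hδp])
  rwa [Real.dist_eq] at this

end Summit.CriticalPhenomena.CardyFormulaZ2.Theorems
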